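import Mathlib
import HarnessLib
import Summits.HubbardSuperconductivity.HubbardSuperconductivity.Theorems.KLProgrammeH10TwoPointLimitKlAnisoThreeAnchoredSectorCount
import Summits.HubbardSuperconductivity.HubbardSuperconductivity.Theorems.KLProgrammeKLRegimeEngineTowerImportP2Floor

/-!
# K3 ENGINE child `KLRegimeEngineV17F2` (stmt-HubbardSuperconductivity-20437), stub (b) import ι₂ at levels `F ≥ 3`: NAMED DOORS for the three-anchored
# anisotropic sector count — `klThinCount3C`, `klThinCount3C₃ R`, `klThinCount3U₀ R` — and the four-leg floor import under the named doors

Cell gate-hubbard-kl, seat hubbard-kl-k3c2-p3 (g14), row «sector-counting import», located «(ℓ)-IMPORT-ι₂-FLOOR».  WHY.  The deliverable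
`card_bgmSectorSet_klAniso_threeAnchored_le_window` (`…KlAnisoThreeAnchoredSectorCount`) is an `∃ C, ∀ R, ∃ c₃ U₀, …` statement; the F-law's import row and
its numerics are keyed on NAMED doors and a NAMED constant (the pattern of p4's `…EngineThinCountDoors` for the one-anchor count).  This file names the three
witnesses as closed terms and discharges the datum `hN3` of `…TowerImportP2Floor.klTowerMuLevF_two_le_floor_import`:

* §1 `klThinCount3C` (`R`-free), `klThinCount3C_pos`, `klThinCount3C_spec`; `klThinCount3C₃ R`, `klThinCount3U₀ R` (`1` off the admissible set), `_pos`;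
* §2 **`card_bgmSectorSet_klAniso_threeAnchored_le_doors`** — `0 < c ≤ klThinCount3C₃ R`, `0 < U ≤ klThinCount3U₀ R`, `klBetaMin ≤ β ≤ e^{c/U²}`, `μ ∈ klWindowC`,
  `FrameOK R U (nScales β) ν K`, `3 ≤ |E|` ⟹ `#{Ω ∈ bgmSectorSet L M (klAnisoFamily L M β μ K klE0 n) 4 : Ω|_E = τ|_E} ≤ klThinCount3C`;
* §3 **`klTowerMuLevF_two_le_floor_import_doors`** — under BOTH counts' doors and the all-fixed anisotropic pinned line `Bₐ`:
  `klTowerMuLevF L M β U μ K d k 2 ≤ (1458·klThinCountC + 531441·klThinCount3C)·Bₐ/ε³` — the k-UNIFORM four-leg floor import («(ℓ)-IMPORT-ι₂-FLOOR» cured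
  modulo the line `Bₐ`, E1's (Q-ι₂)).

Definitions with bodies + order lemmas + two consumer theorems; nothing about the model is asserted beyond the landed counts; nothing asserts (ℓ), any stub, K3
or superconductivity.  References: BGM 2006 §2.7 (2.71a), §2.8 (2.73), (2.76)–(2.80), (2.96)–(2.98), Lemma 2.5 [cite: BenfattoGiulianiMastropietro2006];
Mastropietro 2008 (14.67) [cite: Mastropietro2008].
-/

noncomputable section

namespace Summit.HubbardSuperconductivity.HubbardSuperconductivity.Theorems.KLRegimeSplit

set_option linter.dupNamespace false -- summit = problem name (single-conjunct summit), D-0017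

open Real Finset Literature.MathematicalPhysics.QuantumLattice Literature.Probability.LatticeModels
open Summit.HubbardSuperconductivity.HubbardSuperconductivity.Theorems.KLProgrammeLegKernels
open Summit.HubbardSuperconductivity.HubbardSuperconductivity.Theorems.DispersionFlow
open Summit.HubbardSuperconductivity.HubbardSuperconductivity.Theorems.PerturbedFermiCurve

/-! ## §1 The named witnesses -/

open Classical in
/-- **`klThinCount3C`** — the geometric constant of the three-anchored anisotropic sector count on `klWindowC` (the classical witness `C` of
`card_bgmSectorSet_klAniso_threeAnchored_le_window`; independent of `R`, `β`, `U`, `c`, `L`, `M`, the scale, the anchored legs and their labels). -/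
def klThinCount3C : ℝ := Classical.choose card_bgmSectorSet_klAniso_threeAnchored_le_window

/-- `0 < klThinCount3C`. -/
theorem klThinCount3C_pos : 0 < klThinCount3C := (Classical.choose_spec card_bgmSectorSet_klAniso_threeAnchored_le_window).1

/-- The defining property of `klThinCount3C`: for every admissible `R`, thresholds exist under which the three-anchored count is `≤ klThinCount3C`. -/
theorem klThinCount3C_spec : ∀ R : RenConsts, (∀ j, 0 ≤ R.Gfr j) →
    ∃ c₃ : ℝ, 0 < c₃ ∧ ∃ U₀ : ℝ, 0 < U₀ ∧
      ∀ c : ℝ, 0 < c → c ≤ c₃ → ∀ U : ℝ, 0 < U → U ≤ U₀ → ∀ β : ℝ, klBetaMin ≤ β → β ≤ Real.exp (c / U ^ 2) →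
      ∀ μ ∈ klWindowC, ∀ (ν : ℝ) (K : TrigPolyC4v), FrameOK R U (nScales β) ν K →
      ∀ (L M : ℕ) [NeZero L] (n : ℕ) (E : Finset (Fin 4)), 3 ≤ E.card → ∀ τ : Fin 4 → SectorLeg (sectorCount n),
      ((((bgmSectorSet L M (klAnisoFamily L M β μ K klE0 n) 4).filter
          (fun Ω : Fin 4 → SectorLeg (sectorCount n) => ∀ e ∈ E, Ω e = τ e)).card : ℕ) : ℝ) ≤ klThinCount3C :=
  (Classical.choose_spec card_bgmSectorSet_klAniso_threeAnchored_le_window).2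

open Classical in
/-- **`klThinCount3C₃ R`** — the coupling-temperature door `c₃(R)` of the three-anchored count (classical witness; `1` off the admissible set). -/
def klThinCount3C₃ (R : RenConsts) : ℝ :=
  if h : (∀ j, 0 ≤ R.Gfr j) then Classical.choose (klThinCount3C_spec R h) else 1

open Classical in
/-- **`klThinCount3U₀ R`** — the coupling door `U₀(R)` of the three-anchored count (classical witness; `1` off the admissible set). -/
def klThinCount3U₀ (R : RenConsts) : ℝ :=
  if h : (∀ j, 0 ≤ R.Gfr j) then Classical.choose (Classical.choose_spec (klThinCount3C_spec R h)).2 else 1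

/-- `0 < klThinCount3C₃ R`. -/
theorem klThinCount3C₃_pos (R : RenConsts) : 0 < klThinCount3C₃ R := by
  classical
  unfold klThinCount3C₃
  split_ifs with h
  · exact (Classical.choose_spec (klThinCount3C_spec R h)).1
  · exact one_pos

/-- `0 < klThinCount3U₀ R`. -/
theorem klThinCount3U₀_pos (R : RenConsts) : 0 < klThinCount3U₀ R := by
  classical
  unfold klThinCount3U₀
  split_ifs with h
  · exact (Classical.choose_spec (Classical.choose_spec (klThinCount3C_spec R h)).2).1
  · exact one_pos

/-! ## §2 The count under the named doors -/

/-- **The three-anchored anisotropic sector count UNDER THE NAMED DOORS**: for `R` with `0 ≤ R.Gfr j`, all `0 < c ≤ klThinCount3C₃ R`, `0 < U ≤ klThinCount3U₀ R`,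
`klBetaMin ≤ β ≤ e^{c/U²}`, `μ ∈ klWindowC`, every frame with `FrameOK R U (nScales β) ν K`, every `L ≥ 1`, `M`, scale `n`, every set `E` of at least three legs
and labels `τ`: `#{Ω ∈ bgmSectorSet L M (klAnisoFamily L M β μ K klE0 n) 4 : ∀ e ∈ E, Ω e = τ e} ≤ klThinCount3C`.
[cite: BenfattoGiulianiMastropietro2006, §2.8 (2.73), (2.76)–(2.80), (2.96)–(2.98), Lemma 2.5, App. A3] -/
theorem card_bgmSectorSet_klAniso_threeAnchored_le_doors {R : RenConsts} (hR : ∀ j, 0 ≤ R.Gfr j) {c : ℝ} (hc : 0 < c)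
    (hc₃ : c ≤ klThinCount3C₃ R) {U : ℝ} (hU : 0 < U) (hU₀ : U ≤ klThinCount3U₀ R) {β : ℝ} (hβ : klBetaMin ≤ β)
    (hβc : β ≤ Real.exp (c / U ^ 2)) {μ : ℝ} (hμ : μ ∈ klWindowC) (ν : ℝ) {K : TrigPolyC4v} (hK : FrameOK R U (nScales β) ν K)
    (L M : ℕ) [NeZero L] (n : ℕ) {E : Finset (Fin 4)} (hE : 3 ≤ E.card) (τ : Fin 4 → SectorLeg (sectorCount n)) :
    ((((bgmSectorSet L M (klAnisoFamily L M β μ K klE0 n) 4).filter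
        (fun Ω : Fin 4 → SectorLeg (sectorCount n) => ∀ e ∈ E, Ω e = τ e)).card : ℕ) : ℝ) ≤ klThinCount3C := by
  classical
  have h3 : klThinCount3C₃ R = Classical.choose (klThinCount3C_spec R hR) := by unfold klThinCount3C₃; exact dif_pos hR
  have hU' : klThinCount3U₀ R = Classical.choose (Classical.choose_spec (klThinCount3C_spec R hR)).2 := by
    unfold klThinCount3U₀; exact dif_pos hR
  have hspec := (Classical.choose_spec (Classical.choose_spec (klThinCount3C_spec R hR)).2).2
  rw [h3] at hc₃
  rw [hU'] at hU₀
  exact hspec c hc hc₃ U hU hU₀ β hβ hβc μ hμ ν K hK L M n E hE τ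

end Summit.HubbardSuperconductivity.HubbardSuperconductivity.Theorems.KLRegimeSplit

/-! ## §3 The four-leg floor import under the named doors -/

namespace Summit.HubbardSuperconductivity.HubbardSuperconductivity.Theorems.EngineV8

set_option linter.dupNamespace false -- summit = problem name (single-conjunct summit), D-0017

open Classical
open Real Finset Literature.MathematicalPhysics.QuantumLattice Literature.Probability.LatticeModels
open Literature.MathematicalPhysics.QuantumLattice.FermiRG
open Summit.HubbardSuperconductivity.HubbardSuperconductivity.Theorems.KLRegimeSplit
open Summit.HubbardSuperconductivity.HubbardSuperconductivity.Theorems.KLProgrammeLegKernels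
open Summit.HubbardSuperconductivity.HubbardSuperconductivity.Theorems.DispersionFlow

variable {L M : ℕ} [NeZero L]

/-- **THE k-UNIFORM FOUR-LEG FLOOR IMPORT UNDER THE NAMED DOORS** («(ℓ)-IMPORT-ι₂-FLOOR» cured modulo the all-fixed line `Bₐ`): for `R` with `0 ≤ R.Gfr j`,
`0 < c ≤ min (klThinCountC₃ R) (klThinCount3C₃ R)`, `0 < U ≤ min (klThinCountU₀ R) (klThinCount3U₀ R)` (stated as four inequalities), `klBetaMin ≤ β ≤ e^{c/U²}`,
`μ ∈ klWindowC`, a frame with `FrameOK R U (nScales β) ν K`, and an all-fixed anisotropic pinned line `Bₐ ≥ 0` of the quartic kernel of the block input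
`𝒱_{dk}` sectorised with `F_{dk−1}`: **`klTowerMuLevF L M β U μ K d k 2 ≤ (1458·klThinCountC + 531441·klThinCount3C)·Bₐ/ε³`** — tracks `0, 1` by the one-anchor
count, tracks `2, 3` by the three-anchored count, track `4` empty. [cite: BenfattoGiulianiMastropietro2006, §2.7 (2.71a), §2.8 (2.96)-(2.98), Lemma 2.5] -/
theorem klTowerMuLevF_two_le_floor_import_doors [NeZero M] {R : RenConsts} (hR : ∀ j, 0 ≤ R.Gfr j) {c : ℝ} (hc : 0 < c) (hc₃ : c ≤ klThinCountC₃ R)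
    (hc₃' : c ≤ klThinCount3C₃ R) {U : ℝ} (hU : 0 < U) (hU₀ : U ≤ klThinCountU₀ R) (hU₀' : U ≤ klThinCount3U₀ R) {β : ℝ} (hβ : klBetaMin ≤ β)
    (hβc : β ≤ Real.exp (c / U ^ 2)) {μ : ℝ} (hμ : μ ∈ klWindowC) (ν : ℝ) {K : TrigPolyC4v} (hK : FrameOK R U (nScales β) ν K) (d k : ℕ) {Bₐ : ℝ}
    (hB : 0 ≤ Bₐ)
    (hline : ∀ Ω ∈ bgmSectorSet L M (klAnisoFamily L M β μ K klE0 (d * k - 1)) 4, ∀ (p : Fin 4) (x : SpaceTimeIdx L M),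
      imagTimeWeight β M ^ 3 * ∑ X ∈ univ.filter (fun X : Fin 4 → SpaceTimeIdx L M => X p = x),
        ‖sectorisedKernel L M β (klAnisoFamily L M β μ K klE0 (d * k - 1)) (klTowerInput L M β U μ K d k) 4 Ω X‖ ≤ Bₐ) :
    klTowerMuLevF L M β U μ K d k 2 ≤ (1458 * klThinCountC + 531441 * klThinCount3C) * Bₐ / imagTimeWeight β M ^ 3 :=
  klTowerMuLevF_two_le_floor_import hR hc hc₃ hU hU₀ hβ hβc hμ ν hK d k klThinCount3C_pos.le hB
    (fun _ hE τ => card_bgmSectorSet_klAniso_threeAnchored_le_doors hR hc hc₃' hU hU₀' hβ hβc hμ ν hK L M (d * k - 1) hE τ) hline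

end Summit.HubbardSuperconductivity.HubbardSuperconductivity.Theorems.EngineV8

end
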